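import Summits.NavierStokesRegularity.FluidComputer.ModulatedCollapseGaugeRigidityLocal
import Literature.Analysis.FluidPDE.NecasRuzickaSverakHolds
import Literature.Analysis.FluidPDE.TsaiSelfSimilarHolds
import HarnessLib

/-!
# Liouville theorems for the EXACT one-profile modulated collapse with an ARBITRARY clock:
# the profile is a Leray profile, hence trivial in `L³(ℝ³)` (Nečas–Růžička–Šverák) and in
# `L^q(ℝ³)`, `3 < q < ∞` (Tsai)

Summit `NavierStokesRegularity`, cell topic directory `FluidComputer`, namespace
`…FluidComputer.SelfSimilarCensus`; end of the chain `ModulatedCollapseGaugeRigidity` →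
`ModulatedCollapseGaugeRigidityLocal` (arbitrary `C¹` clock `λ > 0` blowing up at `T`; momentum
equation on a parabolic neighbourhood `(T₀, T) × B(0, r)` of the singular point; conclusion: `U ≡ 0`
or Leray's clock `λ = (2a(T−t))^{-1/2}`, `a > 0`, near `T`). This file reads the SAME two-term
identity once more in the non-trivial branch: with `λ′ = aλ³` it is `λ³ • (aU + a DU·y + (U·∇)U +
∇P − νΔU) = 0`, i.e. **the profile solves Leray's profile system** `IsLerayProfile ν a U P`
(`isLerayProfile_or_eq_zero_of_momentum_ball`, for `U ∈ C²` divergence free, `P ∈ C¹`). Hence the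
tree's DISCHARGED Liouville theorems for Leray profiles apply to every exact one-profile modulated
collapse, whatever its clock:

* `eq_zero_of_momentum_ball_of_memLp_three` — `ν > 0`, `U ∈ L³(ℝ³)` ⇒ `U ≡ 0`
  (`necas_ruzicka_sverak_holds`, NRŠ 1996 Thm 1);
* `eq_zero_of_momentum_ball_of_memLp` — `ν > 0`, `U ∈ L^q(ℝ³)`, `3 < q < ∞` ⇒ `U ≡ 0`
  (`tsai_selfsimilar_holds`, Tsai 1998 Thm 1);
* `eq_zero_of_momentum_of_memLp_three` / `eq_zero_of_momentum_of_memLp` — the same with the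
  momentum equation on whole slices `(T₀, T) × ℝ³`.

For the census `SELFSIM-NOGO.md` ((M5)/(M7): «exact self-similarity ⇒ NRŠ/Tsai») and zone Z7 of the
D-0081 profile search this is the sentence «a generalised self-similar (log-corrected or otherwise
modulated) EXACT one-profile blow-up with an `L³` / `L^q` profile does not exist, for ANY clock» —
as a kernel theorem with no hypothesis on the clock beyond differentiability, positivity and
blow-up. PROVED theorems only; no definitions, no named facts (the two Literature facts used are
discharged in the tree).

WHAT THIS IS NOT: not a statement about similarity-time dependent (DSS / drifting) profiles — the
actual search space of Z7 —, not about profiles outside `L^q`, `3 ≤ q < ∞` (Type-I decay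
`|U| ≲ 1/|y|` is NOT in `L³`), not Navier–Stokes evidence; «violates: none — no object».

References: J. Leray, Acta Math. 63 (1934) §20 [Leray1934]; J. Nečas, M. Růžička, V. Šverák, Acta
Math. 176 (1996), Thm 1 [NecasRuzickaSverak1996]; T.-P. Tsai, ARMA 143 (1998), Thm 1 [Tsai1998].
-/

noncomputable section

open Set Filter Topology InnerProductSpace Metric MeasureTheory
open scoped Laplacian RealInnerProductSpace ENNReal

namespace Summit.NavierStokesRegularity.FluidComputer.SelfSimilarCensus

open Literature.Analysis.FluidPDE

/-! ### §1 The non-trivial branch solves Leray's profile system -/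

section Profile

variable {E : Type*} [NormedAddCommGroup E] [InnerProductSpace ℝ E] [FiniteDimensional ℝ E]
variable {U : E → E} {P : E → ℝ} {lam lam' : ℝ → ℝ} {ν T₀ T r : ℝ}

/-- **From the two-term identity with Leray's readout to the profile equation.** If at one time
`t` with `λ(t) ≠ 0` and `λ′(t) = a λ(t)³` the two-term identity
`λ′ • (U + DU·y)(y) + λ³ • ((U·∇)U + ∇P − νΔU)(y) = 0` holds at `y`, then Leray's profile equation
`−νΔU(y) + aU(y) + a DU(y) y + (U·∇)U(y) + ∇P(y) = 0` holds at `y`. [folklore] -/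
theorem lerayProfileEq_of_twoTerm {a t : ℝ} {y : E} (hne : lam t ≠ 0) (ha : lam' t = a * lam t ^ 3)
    (h : lam' t • (U y + fderiv ℝ U y y) +
      lam t ^ 3 • (convect U U y + gradient P y - ν • (Δ U) y) = 0) :
    -(ν • (Δ U) y) + a • U y + a • fderiv ℝ U y y + convect U U y + gradient P y = 0 := by
  rw [ha] at h
  have h3 : lam t ^ 3 ≠ 0 := pow_ne_zero 3 hne
  have key : lam t ^ 3 • (-(ν • (Δ U) y) + a • U y + a • fderiv ℝ U y y + convect U U y +
      gradient P y) = 0 := by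
    rw [← h]
    module
  exact (smul_eq_zero.1 key).resolve_left h3

/-! Standing hypotheses (LOCAL form): `T₀ < T`, `r > 0`; on `(T₀, T)` the clock `λ` is differentiable
with derivative `λ′`, positive, and `λ → +∞` as `t ↑ T`; `U ∈ C²(E; E)` divergence free, `P ∈ C¹`;
the one-profile modulated ansatz `u = λ(t) • U(λ(t) • x)`, `p = λ(t)² P(λ(t) • x)` satisfies
`∂ₜu + (u·∇)u + ∇p − νΔu = 0` on the parabolic neighbourhood `(T₀, T) × B(0, r)`. -/
variable (hT : T₀ < T) (hr : 0 < r) (hlam : ∀ t ∈ Ioo T₀ T, HasDerivAt lam (lam' t) t)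
  (hpos : ∀ t ∈ Ioo T₀ T, 0 < lam t) (hblow : Tendsto lam (𝓝[<] T) atTop) (hU : ContDiff ℝ 2 U)
  (hP : ContDiff ℝ 1 P) (hdiv : VectorCalculus.IsDivFree U)
  (heq : ∀ t ∈ Ioo T₀ T, ∀ x ∈ ball (0 : E) r,
    timeDeriv (fun s => nsRescaleData (lam s) U) t x +
        convect (nsRescaleData (lam t) U) (nsRescaleData (lam t) U) x +
        gradient (fun y => lam t ^ 2 * P (lam t • y)) x -
        ν • (Δ (nsRescaleData (lam t) U)) x = 0)
include hT hr hlam hpos hblow hU hP hdiv heq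

/-- **The profile of a non-trivial exact one-profile modulated collapse is a LERAY PROFILE.**
Under the standing (local) hypotheses: EITHER `U ≡ 0`, OR there is `a > 0` such that `(U, P)`
solves Leray's profile system `IsLerayProfile ν a U P` AND the clock is Leray's on a terminal
interval, `λ(t) = (2a(T−t))^{-1/2}` for `t ∈ (T₁, T)`. (For each `y` the two-term identity holds
for `t` close to `T` — `eventually_twoTerm_of_momentum_ball` — where also `λ′ = aλ³`.) [folklore] -/
theorem isLerayProfile_or_eq_zero_of_momentum_ball :
    U = 0 ∨ ∃ a T₁ : ℝ, 0 < a ∧ T₀ ≤ T₁ ∧ T₁ < T ∧ IsLerayProfile ν a U P ∧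
      ∀ t ∈ Ioo T₁ T, lam t = (Real.sqrt (2 * a * (T - t)))⁻¹ := by
  have hU1 : ContDiff ℝ 1 U := hU.of_le one_le_two
  rcases scalingGenerator_eq_zero_or_exists_readout_eq_local hT hr hlam hpos hblow hU1 heq with
    hW | ⟨T₁, a, hT₀T₁, hT₁T, ha⟩
  · exact Or.inl (eq_zero_of_scalingGenerator_eq_zero hU1 hW)
  · right
    have hsubI : Ioo T₁ T ⊆ Ioo T₀ T := Ioo_subset_Ioo_left hT₀T₁
    have hlam₁ : ∀ t ∈ Ioo T₁ T, HasDerivAt lam (lam' t) t := fun t ht => hlam t (hsubI ht)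
    have hpos₁ : ∀ t ∈ Ioo T₁ T, 0 < lam t := fun t ht => hpos t (hsubI ht)
    have hne₁ : ∀ t ∈ Ioo T₁ T, lam t ≠ 0 := fun t ht => (hpos₁ t ht).ne'
    obtain ⟨t₁, ht₁⟩ : (Ioo T₁ T).Nonempty := nonempty_Ioo.2 hT₁T
    have ha0 : 0 < a := (inv_sq_eq_leray_of_readout_eq hT₁T hlam₁ hne₁ ha hblow ht₁).1
    refine ⟨a, T₁, ha0, hT₀T₁, hT₁T, ⟨hU, hP, fun y => ?_, hdiv⟩,
      fun t ht => eq_lerayScale_of_readout_eq hT₁T hlam₁ hpos₁ ha hblow ht⟩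
    -- the profile equation at `y`: pick `t` close to `T` in both eventual sets
    obtain ⟨t, htw, htI⟩ := ((eventually_twoTerm_of_momentum_ball hT hr hlam hblow hU1 heq y).and
      (Ioo_mem_nhdsLT hT₁T)).exists
    exact lerayProfileEq_of_twoTerm (hne₁ t htI) (ha t htI) htw

end Profile

/-! ### §2 Liouville in `L³(ℝ³)` and `L^q(ℝ³)`, `3 < q < ∞`, for ANY clock -/

section Liouville

variable {U : EuclideanSpace ℝ (Fin 3) → EuclideanSpace ℝ (Fin 3)} {P : EuclideanSpace ℝ (Fin 3) → ℝ}
  {lam lam' : ℝ → ℝ} {ν T₀ T r : ℝ}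

variable (hT : T₀ < T) (hr : 0 < r) (hlam : ∀ t ∈ Ioo T₀ T, HasDerivAt lam (lam' t) t)
  (hpos : ∀ t ∈ Ioo T₀ T, 0 < lam t) (hblow : Tendsto lam (𝓝[<] T) atTop) (hU : ContDiff ℝ 2 U)
  (hP : ContDiff ℝ 1 P) (hdiv : VectorCalculus.IsDivFree U) (hν : 0 < ν)
  (heq : ∀ t ∈ Ioo T₀ T, ∀ x ∈ ball (0 : EuclideanSpace ℝ (Fin 3)) r,
    timeDeriv (fun s => nsRescaleData (lam s) U) t x +
        convect (nsRescaleData (lam t) U) (nsRescaleData (lam t) U) x +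
        gradient (fun y => lam t ^ 2 * P (lam t • y)) x -
        ν • (Δ (nsRescaleData (lam t) U)) x = 0)
include hT hr hlam hpos hblow hU hP hdiv hν heq

/-- **No exact one-profile modulated collapse with an `L³` profile, for ANY clock** (local form).
`ν > 0`; `U ∈ C²(ℝ³; ℝ³)` divergence free with `U ∈ L³(ℝ³)`, `P ∈ C¹`; clock `λ > 0` differentiable
on `(T₀, T)` with `λ(t) → +∞` as `t ↑ T`; the ansatz `u = λ(t)U(λ(t)x)`, `p = λ²P(λx)` solves
Navier–Stokes momentum on `(T₀, T) × B(0, r)`. Then `U ≡ 0`. (The non-trivial branch is a Leray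
profile with `a > 0`, excluded by Nečas–Růžička–Šverák 1996, Thm 1 — tree
`necas_ruzicka_sverak_holds`.) [folklore] -/
theorem eq_zero_of_momentum_ball_of_memLp_three (hL3 : MemLp U 3) : U = 0 := by
  rcases isLerayProfile_or_eq_zero_of_momentum_ball hT hr hlam hpos hblow hU hP hdiv heq with
    h0 | ⟨a, -, ha0, -, -, hprof, -⟩
  · exact h0
  · exact necas_ruzicka_sverak_holds hν ha0 hprof hL3

/-- **No exact one-profile modulated collapse with an `L^q` profile, `3 < q < ∞`, for ANY clock**
(local form; Tsai 1998, Thm 1 — tree `tsai_selfsimilar_holds` — on the non-trivial branch).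
[folklore] -/
theorem eq_zero_of_momentum_ball_of_memLp {q : ℝ≥0∞} (hq : 3 < q) (hq' : q < ⊤) (hLq : MemLp U q) :
    U = 0 := by
  rcases isLerayProfile_or_eq_zero_of_momentum_ball hT hr hlam hpos hblow hU hP hdiv heq with
    h0 | ⟨a, -, ha0, -, -, hprof, -⟩
  · exact h0
  · exact tsai_selfsimilar_holds hν ha0 hprof hq hq' hLq

end Liouville

/-! ### §3 The same with the momentum equation on whole slices -/

section Global

variable {U : EuclideanSpace ℝ (Fin 3) → EuclideanSpace ℝ (Fin 3)} {P : EuclideanSpace ℝ (Fin 3) → ℝ}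
  {lam lam' : ℝ → ℝ} {ν T₀ T : ℝ}

variable (hT : T₀ < T) (hlam : ∀ t ∈ Ioo T₀ T, HasDerivAt lam (lam' t) t)
  (hpos : ∀ t ∈ Ioo T₀ T, 0 < lam t) (hblow : Tendsto lam (𝓝[<] T) atTop) (hU : ContDiff ℝ 2 U)
  (hP : ContDiff ℝ 1 P) (hdiv : VectorCalculus.IsDivFree U) (hν : 0 < ν)
  (heq : ∀ t ∈ Ioo T₀ T, ∀ x : EuclideanSpace ℝ (Fin 3),
    timeDeriv (fun s => nsRescaleData (lam s) U) t x +
        convect (nsRescaleData (lam t) U) (nsRescaleData (lam t) U) x +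
        gradient (fun y => lam t ^ 2 * P (lam t • y)) x -
        ν • (Δ (nsRescaleData (lam t) U)) x = 0)
include hT hlam hpos hblow hU hP hdiv hν heq

/-- **Global-slice form, `L³`**: an exact one-profile modulated collapse solving Navier–Stokes
momentum on `(T₀, T) × ℝ³` with ANY blowing-up clock and `U ∈ C² ∩ L³` divergence free is trivial.
[folklore] -/
theorem eq_zero_of_momentum_of_memLp_three (hL3 : MemLp U 3) : U = 0 :=
  eq_zero_of_momentum_ball_of_memLp_three hT one_pos hlam hpos hblow hU hP hdiv hν
    (fun t ht x _ => heq t ht x) hL3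

/-- **Global-slice form, `L^q`, `3 < q < ∞`.** [folklore] -/
theorem eq_zero_of_momentum_of_memLp {q : ℝ≥0∞} (hq : 3 < q) (hq' : q < ⊤) (hLq : MemLp U q) :
    U = 0 :=
  eq_zero_of_momentum_ball_of_memLp hT one_pos hlam hpos hblow hU hP hdiv hν
    (fun t ht x _ => heq t ht x) hq hq' hLq

end Global

end Summit.NavierStokesRegularity.FluidComputer.SelfSimilarCensus

end
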